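import Literature.Probability.Process.BrownianRunningSupFourthMoment
import HarnessLib

/-!
# The running supremum of Brownian motion: `L⁴` membership and transfer to Brownian-law processes

Topic `Literature/Probability/Process`; theorems only (no definition, no named fact).
Complements `BrownianRunningSup.lean` (`runSup h = sup_{s ≤ h} |B_s|` over the dyadic grid of
`[0, h]`) and `BrownianRunningSupFourthMoment.lean` (`E[(runSup h)⁴] ≤ 18 h²`, Doob's `L²`
maximal inequality for `B_t² - t`) with the `Lᵖ` packaging and a transfer lemma to processes
having the Brownian path law:

* `memLp_runSup_four`, `memLp_runSup_of_le_four` — `runSup h ∈ L⁴`, hence `∈ Lᵖ` for `p ≤ 4`;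
* `abs_le_iSup_abs_dyadTime` — for a continuous path `f` and `s ≤ h`,
  `|f s| ≤ sup_{grid} |f|` (the grid form of the running supremum dominates on `[0, h]`; the
  path form of `abs_brownian_le_runSup`);
* `exists_memLp_forall_abs_le_of_map_eq_map_brownian` — **transfer**: a process `X` on a
  probability space with measurable marginals, continuous paths and the path law of the
  canonical Brownian motion (`P ∘ (ω ↦ X_·(ω))⁻¹ = W ∘ (ω ↦ B_·(ω))⁻¹`) has, for every `t` and
  `p ≤ 4`, a nonnegative `M ∈ Lᵖ(P)` dominating `|X_u|`, `u ≤ t`, surely — the moment clause of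
  Chelkak–Duminil-Copin–Hongler–Kemppainen–Smirnov's Thm. 3 (C. R. Math. 352 (2014)) for a
  driving process already identified as `√κ B` (used in
  `LatticeModels/FKIsingCylinderIdentityMoments.lean`).

## References

* D. Revuz, M. Yor, *Continuous Martingales and Brownian Motion* (1999), Ch. II, Thm (1.7)
  (Doob's `Lᵖ` inequality). [RevuzYor1999]
-/

noncomputable section

open MeasureTheory ProbabilityTheory Filter Topology Set
open scoped NNReal ENNReal

namespace Literature.Probability.Process

/-! ### `Lᵖ` membership of the running supremum -/

/-- **`runSup h ∈ L⁴`** under the pre-Wiener measure (`integrable_runSup_pow_four`,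
`BrownianRunningSupFourthMoment.lean`). [cite: RevuzYor1999, Ch. II Thm (1.7)] -/
theorem memLp_runSup_four (h : ℝ≥0) : MemLp (runSup h) 4 preWienerMeasure := by
  have hmeas : AEStronglyMeasurable (runSup h) preWienerMeasure :=
    (measurable_runSup h).aestronglyMeasurable
  rw [← integrable_norm_rpow_iff hmeas (by norm_num) (by norm_num)]
  have heq : (fun ω ↦ ‖runSup h ω‖ ^ (4 : ℝ≥0∞).toReal) = fun ω ↦ runSup h ω ^ 4 := by
    funext ω
    rw [Real.norm_eq_abs, abs_of_nonneg (runSup_nonneg h ω), ENNReal.toReal_ofNat,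
      show (4 : ℝ) = (4 : ℕ) by norm_num, Real.rpow_natCast]
  rw [heq]
  exact integrable_runSup_pow_four h

/-- `runSup h ∈ Lᵖ` for every `p ≤ 4` (probability measure). [folklore] -/
theorem memLp_runSup_of_le_four (h : ℝ≥0) {p : ℝ≥0∞} (hp : p ≤ 4) :
    MemLp (runSup h) p preWienerMeasure := by
  haveI := RandomPlanarGeometry.isProbabilityMeasure_preWienerMeasure'
  exact (memLp_runSup_four h).mono_exponent hp

/-! ### The grid supremum dominates a continuous path on `[0, h]` -/

/-- The grid values `|f (dyadTime h n k)|` of a continuous path are bounded above. [folklore] -/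
theorem bddAbove_range_abs_dyadTime {f : ℝ≥0 → ℝ} (hf : Continuous f) (h : ℝ≥0) :
    BddAbove (Set.range fun p : ℕ × ℕ ↦ |f (dyadTime h p.1 p.2)|) := by
  obtain ⟨C, hC⟩ := isCompact_Icc.exists_bound_of_continuousOn (s := Set.Icc (0 : ℝ≥0) h)
    hf.continuousOn
  refine ⟨C, ?_⟩
  rintro _ ⟨p, rfl⟩
  have := hC (dyadTime h p.1 p.2) ⟨bot_le, dyadTime_le h p.1 p.2⟩
  rwa [Real.norm_eq_abs] at this

/-- **For a continuous path `f` and `s ≤ h`, `|f s| ≤ sup_{grid of [0, h]} |f|`** (grid points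
approximate `s` from below). The path form of `abs_brownian_le_runSup`. [folklore] -/
theorem abs_le_iSup_abs_dyadTime {f : ℝ≥0 → ℝ} (hf : Continuous f) {h s : ℝ≥0} (hs : s ≤ h) :
    |f s| ≤ ⨆ p : ℕ × ℕ, |f (dyadTime h p.1 p.2)| := by
  have hbdd := bddAbove_range_abs_dyadTime hf h
  have hgrid : ∀ n k, |f (dyadTime h n k)| ≤ ⨆ p : ℕ × ℕ, |f (dyadTime h p.1 p.2)| :=
    fun n k ↦ le_ciSup hbdd (n, k)
  rcases eq_or_ne h 0 with rfl | h0
  · have : s = 0 := le_antisymm hs bot_le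
    subst this
    have e : dyadTime 0 0 0 = 0 := by simp [dyadTime]
    calc |f 0| = |f (dyadTime 0 0 0)| := by rw [e]
      _ ≤ _ := hgrid 0 0
  have hpos : (0 : ℝ) < h := lt_of_le_of_ne h.coe_nonneg (fun h' ↦ h0 (by exact_mod_cast h'.symm))
  -- the grid points `tₙ = (⌊s 2ⁿ / h⌋ h / 2ⁿ) ∧ h → s`
  set k : ℕ → ℕ := fun n ↦ ⌊(s : ℝ) / h * 2 ^ n⌋₊ with hk
  have hbounds : ∀ n, (dyadTime h n (k n) : ℝ) ≤ s ∧ (s : ℝ) - h / 2 ^ n ≤ dyadTime h n (k n) := by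
    intro n
    have hfl := Nat.floor_le (by positivity : (0 : ℝ) ≤ (s : ℝ) / h * 2 ^ n)
    have hfl' : (s : ℝ) / h * 2 ^ n < k n + 1 := Nat.lt_floor_add_one _
    have hval : ((h * ((k n : ℝ≥0) / 2 ^ n) : ℝ≥0) : ℝ) = h * (k n : ℝ) / 2 ^ n := by push_cast; ring
    have hle : ((h * ((k n : ℝ≥0) / 2 ^ n) : ℝ≥0) : ℝ) ≤ s := by
      rw [hval, div_le_iff₀ (by positivity)]
      calc (h : ℝ) * (k n) ≤ h * ((s : ℝ) / h * 2 ^ n) := mul_le_mul_of_nonneg_left hfl h.coe_nonneg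
        _ = s * 2 ^ n := by field_simp
    have hmin : dyadTime h n (k n) = h * ((k n : ℝ≥0) / 2 ^ n) := by
      rw [dyadTime, min_eq_left]
      exact_mod_cast hle.trans (by exact_mod_cast hs : (s : ℝ) ≤ h)
    refine ⟨by rw [hmin]; exact hle, ?_⟩
    rw [hmin, hval, le_div_iff₀ (by positivity)]
    rw [div_mul_eq_mul_div, div_lt_iff₀ hpos] at hfl'
    have h2n : (0 : ℝ) < 2 ^ n := by positivity
    have : ((s : ℝ) - h / 2 ^ n) * 2 ^ n = s * 2 ^ n - h := by field_simp
    rw [this]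
    nlinarith
  have hconv : Tendsto (fun n ↦ (dyadTime h n (k n) : ℝ)) atTop (𝓝 s) := by
    refine tendsto_of_tendsto_of_tendsto_of_le_of_le ?_ tendsto_const_nhds (fun n ↦ (hbounds n).2)
      (fun n ↦ (hbounds n).1)
    have h1 : Tendsto (fun n : ℕ ↦ (h : ℝ) / 2 ^ n) atTop (𝓝 0) := by
      have := (tendsto_pow_atTop_nhds_zero_of_lt_one (r := (1 / 2 : ℝ)) (by norm_num)
        (by norm_num)).const_mul (h : ℝ)
      rw [mul_zero] at this
      refine this.congr fun n ↦ ?_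
      rw [one_div, inv_pow, div_eq_mul_inv]
    simpa using tendsto_const_nhds.sub h1
  have hconv' : Tendsto (fun n ↦ dyadTime h n (k n)) atTop (𝓝 s) := NNReal.tendsto_coe.1 hconv
  have hcont : Tendsto (fun n ↦ |f (dyadTime h n (k n))|) atTop (𝓝 |f s|) :=
    ((hf.tendsto s).comp hconv').abs
  exact le_of_tendsto' hcont fun n ↦ hgrid n (k n)

/-! ### Transfer to processes with the Brownian path law -/

/-- The grid supremum of `|ω ·|` over `[0, h]`, as a functional of the raw path, is measurable.
[folklore] -/
theorem measurable_iSup_abs_apply_dyadTime (h : ℝ≥0) :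
    Measurable fun ω : ℝ≥0 → ℝ ↦ ⨆ p : ℕ × ℕ, |ω (dyadTime h p.1 p.2)| :=
  Measurable.iSup fun p ↦ (measurable_pi_apply (dyadTime h p.1 p.2)).abs

/-- **Moments of the running supremum transfer along the Brownian path law.** Let `X` be a
process on a probability space `(Ω, P)` with measurable marginals and continuous paths whose path
law is that of the canonical Brownian motion: `P ∘ (ω ↦ (t ↦ X_t ω))⁻¹ = W ∘ (ω ↦ (t ↦ B_t ω))⁻¹`.
Then for every `t` and every `p ≤ 4` there is a nonnegative `M ∈ Lᵖ(P)` with `|X_u ω| ≤ M ω` for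
all `ω` and all `u ≤ t` (namely the grid supremum of `|X_· ω|` over `[0, t]`, whose law is that
of `runSup t`). [cite: RevuzYor1999, Ch. II Thm (1.7)] -/
theorem exists_memLp_forall_abs_le_of_map_eq_map_brownian {Ω : Type*} [MeasurableSpace Ω]
    {P : Measure Ω} [IsProbabilityMeasure P] {X : ℝ≥0 → Ω → ℝ} (hXm : ∀ t, Measurable (X t))
    (hXc : ∀ ω, Continuous (X · ω))
    (hlaw : P.map (fun ω t ↦ X t ω) = preWienerMeasure.map (fun ω t ↦ brownian t ω))
    (t : ℝ≥0) {p : ℝ≥0∞} (hp : p ≤ 4) :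
    ∃ M : Ω → ℝ, MemLp M p P ∧ (∀ ω, 0 ≤ M ω) ∧ ∀ ω u, u ≤ t → |X u ω| ≤ M ω := by
  set R : (ℝ≥0 → ℝ) → ℝ := fun ω ↦ ⨆ q : ℕ × ℕ, |ω (dyadTime t q.1 q.2)| with hR
  have hRm : Measurable R := measurable_iSup_abs_apply_dyadTime t
  have hpaths : Measurable fun ω (u : ℝ≥0) ↦ X u ω := measurable_pi_lambda _ hXm
  have hbpaths : Measurable fun (ω : ℝ≥0 → ℝ) (u : ℝ≥0) ↦ brownian u ω :=
    measurable_pi_lambda _ measurable_brownian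
  refine ⟨fun ω ↦ R (fun u ↦ X u ω), ?_, fun ω ↦ ?_, fun ω u hu ↦ ?_⟩
  · -- `Lᵖ` through the path law
    have h1 : MemLp R p (P.map fun ω u ↦ X u ω) := by
      rw [hlaw]
      refine (memLp_map_measure_iff hRm.aestronglyMeasurable hbpaths.aemeasurable).2 ?_
      exact memLp_runSup_of_le_four t hp
    exact (memLp_map_measure_iff hRm.aestronglyMeasurable hpaths.aemeasurable).1 h1
  · exact le_ciSup_of_le (bddAbove_range_abs_dyadTime (hXc ω) t) (0, 0) (abs_nonneg _)
  · exact abs_le_iSup_abs_dyadTime (hXc ω) hu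

end Literature.Probability.Process
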